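import Mathlib
import HarnessLib
import Summits.HubbardSuperconductivity.HubbardSuperconductivity.Theorems.KLProgrammePerturbedFermiCurveTwoFrameRegime
import Summits.HubbardSuperconductivity.HubbardSuperconductivity.Theorems.KLProgrammePerturbedFermiCurveTowerOfSizes
import Summits.HubbardSuperconductivity.HubbardSuperconductivity.Theorems.KLProgrammePerturbedFermiCurveNumerics
import Summits.HubbardSuperconductivity.HubbardSuperconductivity.Theorems.KLProgrammePerturbedFermiCurveTwoFrameGradedArith2

/-!
# Route `KLProgramme` — K3 engine child (stmt-HubbardSuperconductivity-19918, `stub_twoLeg_step`, clause (E3a-MS) `TwoLegSizesMST`):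
# the two-frame implicit-function tower, TWO-PARAMETER graded form (`E₀ ≤ e₀`, `E_i ≤ e·λ^i`, `i ≥ 1`), with numerals

Cell `gate-hubbard-kl`, seat hubbard-kl-k3c3-p3 (g3) «implicit-function / monotonicity route for μ(n)», part (P2) of the (L)+(F) recipe.
Companion of `…TwoFrameGraded` (one-parameter grading).  In slot `m` of (F) the sup of the high part of piece `m` is `E₀ ≍ U²4^{−n−m}`
(Jackson, order one, `d = 4ⁿ`) while its derivative sizes are `E_i ≍ U²4^{(i−2)m}` (`i ≥ 1`); carrying `E₀ ≤ e₀` separately from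
`E_i ≤ e·λ^i` keeps every slot comparison `O(4^{−n})` (P2-INTERFACE §8).  Under the same frame hypotheses (`A ≤ 1/20`, `A₃ ≤ λ`, `A₄ ≤ λ²`):

* §1 `abs_deriv_tower_frameRadius_sub_le_graded₂`:
  `W₀ ≤ 6.1·e₀`, `W₁ ≤ 703·eλ + 1.81·10⁴·e₀`, `W₂ ≤ 6.39·10⁶·eλ² + 1.68·10⁸·e₀λ`, `W₃ ≤ 9.87·10¹⁰·eλ³ + 2.6·10¹²·e₀λ²`,
  `W₄ ≤ 2.14·10¹⁵·eλ⁴ + 5.65·10¹⁶·e₀λ² + 3.46·10¹⁰·A₄`;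
* §2 `norm_iteratedFDeriv_fermiPointLp_sub_le_graded₂`: `‖γ_{K′} − γ_K‖ ≤ 12.2·e₀`,
  `‖Dⁱγ_{K′} − Dⁱγ_K‖ ≤ 1420·eλ + 3.64·10⁴·e₀, 1.29·10⁷·eλ² + 3.38·10⁸·e₀λ, 1.99·10¹¹·eλ³ + 5.23·10¹²·e₀λ²,
  4.3·10¹⁵·eλ⁴ + 1.14·10¹⁷·e₀λ² + 6.92·10¹⁰·A₄`.

The `e₀`-content grows at most like `λ²` (through `A₃W₀`, `A₄W₀`, `R₄W₀`).  Arithmetic in `…TwoFrameGradedArith2`.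
Everything is PROVED; no definitions, no named facts. [cite: BenfattoGiulianiMastropietro2006, §2.4 Lemma 2.1 (2.40)]
-/

noncomputable section

namespace Summit.HubbardSuperconductivity.HubbardSuperconductivity.Theorems.PerturbedFermiCurve

set_option linter.dupNamespace false -- summit = problem name (single-conjunct summit), D-0017
set_option maxSynthPendingDepth 3 -- nested operator-norm instances (third/fourth Fréchet derivatives)

open Real Set
open Literature.MathematicalPhysics.QuantumLattice Literature.MathematicalPhysics.QuantumLattice.BandSectorCounting
open Summit.HubbardSuperconductivity.HubbardSuperconductivity.Theorems.DispersionFlow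
open Summit.HubbardSuperconductivity.HubbardSuperconductivity.Theorems.KLRegimeSplit

/-! ## §1 The radius towers of two frames, graded -/

section Graded

variable {K K' : TrigPolyC4v} {A : ℝ}
  (hA : ∀ p : Momentum, ∀ j ≤ 2, ‖iteratedFDeriv ℝ j (frameShift K) p‖ ≤ A)
  (hA' : ∀ p : Momentum, ∀ j ≤ 2, ‖iteratedFDeriv ℝ j (frameShift K') p‖ ≤ A) (hA20 : A ≤ 1 / 20)
  (hd : klCurveD ≤ (bandBounds (show (-4 : ℝ) < -1.1 by norm_num) (show (-1.1 : ℝ) ≤ -0.1 by norm_num)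
    (show (-0.1 : ℝ) < 0 by norm_num)).Dtmin - 2 * A)
  {ν : ℝ} (hlo : (-1.1 : ℝ) ≤ ν - A) (hhi : ν + A ≤ -0.1)
  {A₃ A₄ e e₀ l : ℝ} (he : 0 ≤ e) (he₀ : 0 ≤ e₀) (hl : 1 ≤ l)
  (hA₃ : ∀ p : Momentum, ‖iteratedFDeriv ℝ 3 (frameShift K) p‖ ≤ A₃)
  (hA₃' : ∀ p : Momentum, ‖iteratedFDeriv ℝ 3 (frameShift K') p‖ ≤ A₃) (hA₃l : A₃ ≤ l)
  (hA₄ : ∀ p : Momentum, ‖iteratedFDeriv ℝ 4 (frameShift K) p‖ ≤ A₄)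
  (hA₄' : ∀ p : Momentum, ‖iteratedFDeriv ℝ 4 (frameShift K') p‖ ≤ A₄) (hA₄l : A₄ ≤ l ^ 2)
  (hE₀ : ∀ k : Fin 2 → ℝ, (∀ i, |k i| ≤ π) → |(fun p : Fin 2 → ℝ => -K'.eval p) k - (fun p : Fin 2 → ℝ => -K.eval p) k| ≤ e₀)
  (hE₁ : ∀ k : Fin 2 → ℝ, (∀ i, |k i| ≤ π) →
    ‖fderiv ℝ (fun p : Fin 2 → ℝ => -K'.eval p) k - fderiv ℝ (fun p : Fin 2 → ℝ => -K.eval p) k‖ ≤ e * l)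
  (hE₂ : ∀ k : Fin 2 → ℝ, (∀ i, |k i| ≤ π) →
    ‖fderiv ℝ (fderiv ℝ (fun p : Fin 2 → ℝ => -K'.eval p)) k - fderiv ℝ (fderiv ℝ (fun p : Fin 2 → ℝ => -K.eval p)) k‖ ≤ e * l ^ 2)
  (hE₃ : ∀ k : Fin 2 → ℝ, (∀ i, |k i| ≤ π) →
    ‖fderiv ℝ (fderiv ℝ (fderiv ℝ (fun p : Fin 2 → ℝ => -K'.eval p))) k -
      fderiv ℝ (fderiv ℝ (fderiv ℝ (fun p : Fin 2 → ℝ => -K.eval p))) k‖ ≤ e * l ^ 3)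
  (hE₄ : ∀ k : Fin 2 → ℝ, (∀ i, |k i| ≤ π) →
    ‖fderiv ℝ (fderiv ℝ (fderiv ℝ (fderiv ℝ (fun p : Fin 2 → ℝ => -K'.eval p)))) k -
      fderiv ℝ (fderiv ℝ (fderiv ℝ (fderiv ℝ (fun p : Fin 2 → ℝ => -K.eval p)))) k‖ ≤ e * l ^ 4)
include hA hA' hA20 hd hlo hhi he he₀ hl hA₃ hA₃' hA₃l hA₄ hA₄' hA₄l hE₀ hE₁ hE₂ hE₃ hE₄

/-- **The radius towers of two `C²`-small frames at a common level, TWO-PARAMETER GRADED**: if both frames have `C²` size `A ≤ 1/20` (window margins,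
`klCurveD ≤ Dt_min − 2A`), `C³` size `A₃ ≤ λ`, `C⁴` size `A₄ ≤ λ²` (`λ ≥ 1`), and `δ_{K′} − δ_K` has nested sizes `E_i ≤ e·λ^i` on the
closed square (`E₀ ≤ e₀`, `E_i ≤ e·λ^i` for `i ≥ 1`), then at every angle `|u_{K′} − u_K| ≤ 6.1e₀`, `|u′…| ≤ 703·eλ + 18100·e₀`,
`|u″…| ≤ 6.39·10⁶·eλ² + 1.68·10⁸·e₀λ`, `|u‴…| ≤ 9.87·10¹⁰·eλ³ + 2.6·10¹²·e₀λ²`, `|u⁗…| ≤ 2.14·10¹⁵·eλ⁴ + 5.65·10¹⁶·e₀λ² + 3.46·10¹⁰·A₄`.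
[cite: BenfattoGiulianiMastropietro2006, §2.4 Lemma 2.1 (2.40)] -/
theorem abs_deriv_tower_frameRadius_sub_le_graded₂ (θ : ℝ) :
    |perturbedFermiRadius (fun p : Fin 2 → ℝ => -K'.eval p) ν θ - perturbedFermiRadius (fun p : Fin 2 → ℝ => -K.eval p) ν θ| ≤
      6.1 * e₀ ∧
    |deriv (perturbedFermiRadius (fun p : Fin 2 → ℝ => -K'.eval p) ν) θ -
        deriv (perturbedFermiRadius (fun p : Fin 2 → ℝ => -K.eval p) ν) θ| ≤ 703 * e * l + 18100 * e₀ ∧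
    |deriv (deriv (perturbedFermiRadius (fun p : Fin 2 → ℝ => -K'.eval p) ν)) θ -
        deriv (deriv (perturbedFermiRadius (fun p : Fin 2 → ℝ => -K.eval p) ν)) θ| ≤ 6390000 * e * l ^ 2 + 168000000 * e₀ * l ∧
    |deriv (deriv (deriv (perturbedFermiRadius (fun p : Fin 2 → ℝ => -K'.eval p) ν))) θ -
        deriv (deriv (deriv (perturbedFermiRadius (fun p : Fin 2 → ℝ => -K.eval p) ν))) θ| ≤
      98700000000 * e * l ^ 3 + 2600000000000 * e₀ * l ^ 2 ∧
    |deriv (deriv (deriv (deriv (perturbedFermiRadius (fun p : Fin 2 → ℝ => -K'.eval p) ν)))) θ -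
        deriv (deriv (deriv (deriv (perturbedFermiRadius (fun p : Fin 2 → ℝ => -K.eval p) ν)))) θ| ≤
      2140000000000000 * e * l ^ 4 + 56500000000000000 * e₀ * l ^ 2 + 34600000000 * A₄ := by
  set B := bandBounds (show (-4 : ℝ) < -1.1 by norm_num) (show (-1.1 : ℝ) ≤ -0.1 by norm_num) (show (-0.1 : ℝ) < 0 by norm_num)
    with hBdef
  have hDpos := klCurveD_pos
  have hADt : 2 * A < B.Dtmin := by linarith
  have hρ : (33 : ℝ) / 200 ≤ B.Dtmin - 2 * A := klCurveD_ge.trans hd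
  have hρ0 : 0 < B.Dtmin - 2 * A := by linarith
  have hA0 : 0 ≤ A := (norm_nonneg _).trans (hA 0 0 (by norm_num))
  have hA₃0 : 0 ≤ A₃ := (norm_nonneg _).trans (hA₃ 0)
  have hA₄0 : 0 ≤ A₄ := (norm_nonneg _).trans (hA₄ 0)
  have hs0 : 0 ≤ π * Real.sqrt 2 := pi_mul_sqrt_two_nonneg
  have hs : π * Real.sqrt 2 ≤ 4.45 := pi_mul_sqrt_two_le
  have hl0 : 0 ≤ l := zero_le_one.trans hl
  obtain ⟨-, hR₁, hR₂, hR₃, hR₄⟩ := frameRadius_tower_of_sizes hA hA20 hd hlo hhi hA₃ hA₄ θ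
  obtain ⟨-, hR₁', hR₂', hR₃', -⟩ := frameRadius_tower_of_sizes hA' hA20 hd hlo hhi hA₃' hA₄' θ
  have hT3 : klCurveT3 A₃ ≤ 3200000000 + 76000000 * l := (klCurveT3_le hA₃0).trans (by nlinarith)
  have hT30 : 0 ≤ klCurveT3 A₃ := klCurveT3_nonneg hA₃0
  have hT4 : klCurveT4 A₃ A₄ ≤ 49000000000000 + 2300000000000 * l + 18000000000 * l ^ 2 :=
    (klCurveT4_le hA₃0 hA₄0).trans (by nlinarith)
  have he1 : 0 ≤ e * l := by positivity
  have he2 : 0 ≤ e * l ^ 2 := by positivity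
  -- order 0
  have he₀1 : 0 ≤ e₀ * l := by positivity
  have gW₀ : |perturbedFermiRadius (fun p : Fin 2 → ℝ => -K'.eval p) ν θ -
      perturbedFermiRadius (fun p : Fin 2 → ℝ => -K.eval p) ν θ| ≤ 6.1 * e₀ := by
    refine (abs_frameRadius_sub_le B hA hA' hADt hlo hhi hE₀ θ).trans ?_
    rw [div_le_iff₀ hρ0]; nlinarith
  -- order 1
  have gW₁ : |deriv (perturbedFermiRadius (fun p : Fin 2 → ℝ => -K'.eval p) ν) θ -
      deriv (perturbedFermiRadius (fun p : Fin 2 → ℝ => -K.eval p) ν) θ| ≤ 703 * e * l + 18100 * e₀ :=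
    (abs_deriv_frameRadius_sub_le B hA hA' hADt hlo hhi hE₀ hE₁ θ).trans
      (graded2_aux_one hρ hA0 hA20 hs0 hs he he₀ hl he₀ le_rfl he1 le_rfl)
  have gW₁0 : 0 ≤ 703 * e * l + 18100 * e₀ := by positivity
  -- order 2
  obtain ⟨h2, -, -⟩ := abs_deriv_tower_frameRadius_sub_le B hA hA' hADt hlo hhi hE₀ hA₃ hA₄ hE₁ hE₂ hE₃ hE₄ hR₁ hR₁' hR₂ hR₂' hR₃
    hR₃' hR₄ gW₁ le_rfl le_rfl
  have gW₂ : |deriv (deriv (perturbedFermiRadius (fun p : Fin 2 → ℝ => -K'.eval p) ν)) θ -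
      deriv (deriv (perturbedFermiRadius (fun p : Fin 2 → ℝ => -K.eval p) ν)) θ| ≤ 6390000 * e * l ^ 2 + 168000000 * e₀ * l :=
    h2.trans (graded2_aux_two hρ hA0 hA20 hs0 hs klCurveR1_nonneg klCurveR1_le klCurveR2_le he he₀ hl hA₃l he₀ le_rfl he1 le_rfl
      le_rfl gW₁0 le_rfl)
  have gW₂0 : 0 ≤ 6390000 * e * l ^ 2 + 168000000 * e₀ * l := by positivity
  -- order 3
  obtain ⟨-, h3, -⟩ := abs_deriv_tower_frameRadius_sub_le B hA hA' hADt hlo hhi hE₀ hA₃ hA₄ hE₁ hE₂ hE₃ hE₄ hR₁ hR₁' hR₂ hR₂' hR₃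
    hR₃' hR₄ gW₁ gW₂ le_rfl
  have gW₃ : |deriv (deriv (deriv (perturbedFermiRadius (fun p : Fin 2 → ℝ => -K'.eval p) ν))) θ -
      deriv (deriv (deriv (perturbedFermiRadius (fun p : Fin 2 → ℝ => -K.eval p) ν))) θ| ≤
      98700000000 * e * l ^ 3 + 2600000000000 * e₀ * l ^ 2 :=
    h3.trans (graded2_aux_three hρ hA0 hA20 hs0 hs klCurveR1_nonneg klCurveR1_le klCurveR2_nonneg klCurveR2_le hT3 he he₀ hl hA₃l
      hA₄l he₀ le_rfl he1 le_rfl le_rfl le_rfl gW₁0 le_rfl gW₂0 le_rfl)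
  have gW₃0 : 0 ≤ 98700000000 * e * l ^ 3 + 2600000000000 * e₀ * l ^ 2 := by positivity
  -- order 4
  obtain ⟨-, -, h4⟩ := abs_deriv_tower_frameRadius_sub_le B hA hA' hADt hlo hhi hE₀ hA₃ hA₄ hE₁ hE₂ hE₃ hE₄ hR₁ hR₁' hR₂ hR₂' hR₃
    hR₃' hR₄ gW₁ gW₂ gW₃
  have gW₄ := h4.trans (graded2_aux_four hρ hA0 hA20 hs0 hs klCurveR1_nonneg klCurveR1_le klCurveR2_nonneg klCurveR2_le hT30 hT3
    hT4 he he₀ hl hA₃l hA₄0 hA₄l he₀ le_rfl he1 le_rfl le_rfl le_rfl le_rfl gW₁0 le_rfl gW₂0 le_rfl gW₃0 le_rfl)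
  exact ⟨gW₀, gW₁, gW₂, gW₃, gW₄⟩

/-! ## §2 The curve towers of two frames, graded -/

/-- **The curve towers of two frames, GRADED** (`γ_K θ = toLp 2 (klFermiPoint ν K θ)`): under the hypotheses of
`abs_deriv_tower_frameRadius_sub_le_graded₂`, at every angle `‖γ_{K′} − γ_K‖ ≤ 12.2·e₀`, `‖D¹…‖ ≤ 1420·eλ + 3.64·10⁴·e₀`,
`‖D²…‖ ≤ 1.29·10⁷·eλ² + 3.38·10⁸·e₀λ`, `‖D³…‖ ≤ 1.99·10¹¹·eλ³ + 5.23·10¹²·e₀λ²`, `‖D⁴…‖ ≤ 4.3·10¹⁵·eλ⁴ + 1.14·10¹⁷·e₀λ² + 6.92·10¹⁰·A₄`.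
[folklore] -/
theorem norm_iteratedFDeriv_fermiPointLp_sub_le_graded₂ (θ : ℝ) :
    ‖(WithLp.toLp 2 (klFermiPoint ν K' θ) : Momentum) - WithLp.toLp 2 (klFermiPoint ν K θ)‖ ≤ 12.2 * e₀ ∧
    ‖iteratedFDeriv ℝ 1 (fun θ : ℝ => (WithLp.toLp 2 (klFermiPoint ν K' θ) : Momentum)) θ -
        iteratedFDeriv ℝ 1 (fun θ : ℝ => (WithLp.toLp 2 (klFermiPoint ν K θ) : Momentum)) θ‖ ≤ 1420 * e * l + 36400 * e₀ ∧
    ‖iteratedFDeriv ℝ 2 (fun θ : ℝ => (WithLp.toLp 2 (klFermiPoint ν K' θ) : Momentum)) θ -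
        iteratedFDeriv ℝ 2 (fun θ : ℝ => (WithLp.toLp 2 (klFermiPoint ν K θ) : Momentum)) θ‖ ≤
      12900000 * e * l ^ 2 + 338000000 * e₀ * l ∧
    ‖iteratedFDeriv ℝ 3 (fun θ : ℝ => (WithLp.toLp 2 (klFermiPoint ν K' θ) : Momentum)) θ -
        iteratedFDeriv ℝ 3 (fun θ : ℝ => (WithLp.toLp 2 (klFermiPoint ν K θ) : Momentum)) θ‖ ≤
      199000000000 * e * l ^ 3 + 5230000000000 * e₀ * l ^ 2 ∧
    ‖iteratedFDeriv ℝ 4 (fun θ : ℝ => (WithLp.toLp 2 (klFermiPoint ν K' θ) : Momentum)) θ -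
        iteratedFDeriv ℝ 4 (fun θ : ℝ => (WithLp.toLp 2 (klFermiPoint ν K θ) : Momentum)) θ‖ ≤
      4300000000000000 * e * l ^ 4 + 114000000000000000 * e₀ * l ^ 2 + 69200000000 * A₄ := by
  set B := bandBounds (show (-4 : ℝ) < -1.1 by norm_num) (show (-1.1 : ℝ) ≤ -0.1 by norm_num) (show (-0.1 : ℝ) < 0 by norm_num)
    with hBdef
  have hDpos := klCurveD_pos
  have hADt : 2 * A < B.Dtmin := by linarith
  have hA₄0 : 0 ≤ A₄ := (norm_nonneg _).trans (hA₄ 0)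
  obtain ⟨gW₀, gW₁, gW₂, gW₃, gW₄⟩ := abs_deriv_tower_frameRadius_sub_le_graded₂ hA hA' hA20 hd hlo hhi he he₀ hl hA₃ hA₃' hA₃l hA₄ hA₄'
    hA₄l hE₀ hE₁ hE₂ hE₃ hE₄ θ
  obtain ⟨d1, d2, d3, d4⟩ := norm_iteratedFDeriv_fermiPointLp_sub_le_four_orders B hA hA' hADt hlo hhi gW₀ gW₁ gW₂ gW₃ gW₄
  have h01 : e ≤ e * l := by nlinarith
  have h02 : e ≤ e * l ^ 2 := by simpa using graded_mono he hl (show 0 ≤ 2 by norm_num)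
  have h12 : e * l ≤ e * l ^ 2 := by simpa using graded_mono he hl (show 1 ≤ 2 by norm_num)
  have h03 : e ≤ e * l ^ 3 := by simpa using graded_mono he hl (show 0 ≤ 3 by norm_num)
  have h13 : e * l ≤ e * l ^ 3 := by simpa using graded_mono he hl (show 1 ≤ 3 by norm_num)
  have h23 : e * l ^ 2 ≤ e * l ^ 3 := graded_mono he hl (show 2 ≤ 3 by norm_num)
  have h04 : e ≤ e * l ^ 4 := by simpa using graded_mono he hl (show 0 ≤ 4 by norm_num)
  have h14 : e * l ≤ e * l ^ 4 := by simpa using graded_mono he hl (show 1 ≤ 4 by norm_num)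
  have h24 : e * l ^ 2 ≤ e * l ^ 4 := graded_mono he hl (show 2 ≤ 4 by norm_num)
  have h34 : e * l ^ 3 ≤ e * l ^ 4 := graded_mono he hl (show 3 ≤ 4 by norm_num)
  have k01 : e₀ ≤ e₀ * l := by nlinarith
  have k02 : e₀ ≤ e₀ * l ^ 2 := by simpa using graded_mono he₀ hl (show 0 ≤ 2 by norm_num)
  have k12 : e₀ * l ≤ e₀ * l ^ 2 := by simpa using graded_mono he₀ hl (show 1 ≤ 2 by norm_num)
  have key : (WithLp.toLp 2 (klFermiPoint ν K' θ) : Momentum) - WithLp.toLp 2 (klFermiPoint ν K θ) =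
      WithLp.toLp 2 ((perturbedFermiRadius (fun p : Fin 2 → ℝ => -K'.eval p) ν θ -
        perturbedFermiRadius (fun p : Fin 2 → ℝ => -K.eval p) ν θ) • dir θ) := by
    rw [← WithLp.toLp_sub, sub_smul]; rfl
  have d0 : ‖(WithLp.toLp 2 (klFermiPoint ν K' θ) : Momentum) - WithLp.toLp 2 (klFermiPoint ν K θ)‖ ≤ 12.2 * e₀ := by
    rw [key]
    refine (norm_toLp_two_le _).trans ?_
    rw [norm_smul, Real.norm_eq_abs]
    have h1 := norm_dir_le_one θ
    have := mul_le_mul gW₀ h1 (norm_nonneg _) (by positivity)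
    linarith
  exact ⟨d0, d1.trans (by linarith), d2.trans (by linarith), d3.trans (by linarith), d4.trans (by linarith)⟩

end Graded

end Summit.HubbardSuperconductivity.HubbardSuperconductivity.Theorems.PerturbedFermiCurve

end
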